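import Mathlib
import Summits.QuantumAdvantage.QuantumAdvantage.Theses.LinnikCubicClassGroups
import Literature.NumberTheory.NumberFields.PureCubicGenusDivisor
import HarnessLib

/-!
# `stub_genus` of line `JuntaLadder` (crux `PureCubicClassNumberHard`, stmt-QuantumAdvantage-11826): genus theory for pure cubic fields with a general radicand

Crux `stmt-QuantumAdvantage-11826` (route `LinnikCubicClassGroups`, rank-0 hypothesis-type target
`X = PureCubicClassNumberHard`), line `JuntaLadder`
(`Cruxes/PureCubicClassNumberHard/Lines/JuntaLadder.lean`, forward ladder generator G4), registered
stub `stub_genus : GenusLemma` (graded L by the planner), proved here with the statement unfolded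
verbatim:

> a prime `ℓ ≡ 1 (mod 3)` dividing `m` exactly once makes `3 ∣ h(K)` for every cubic number field
> `K ∋ ∛m`.

This is the Literature theorem `Honda1971.three_dvd_classNumber_of_padicValNat_eq_one`
(`Literature/NumberTheory/NumberFields/PureCubicGenusDivisor.lean`, this seat): Honda 1971 §1 /
Ishida LNM 555 eq. (7.7) — the cubic subfield `C` of `ℚ(ζ_ℓ)` gives an unramified cyclic cubic
extension `KC/K` (Abhyankar at `ℓ`, where `e(ℓ, K) = 3`), and the tree's Artin map for unramified
cyclic extensions of odd degree gives `3 ∣ h_K`.  The tree previously had the case `m = pq` only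
(`Honda1971.three_dvd_classNumber_of_prime_mod_three`).

HONEST FRAMING (block-2b rule): the value here is a closed registered stub resting on a kernel-checked
classical theorem, NOT summit progress; the crux itself is hypothesis-type.
-/

namespace Summit.QuantumAdvantage.QuantumAdvantage.Theorems.LinnikCubicClassGroups

/-- **Registered stub `stub_genus` of line `JuntaLadder`** (`GenusLemma` of
`Cruxes/PureCubicClassNumberHard/Lines/JuntaLadder.lean`, unfolded verbatim): for a prime
`ℓ ≡ 1 (mod 3)` with `v_ℓ(m) = 1` and every cubic number field `K` containing a cube root of `m`,
`3 ∣ h(K)`. [cite: Honda1971, §1 and Theorem] [cite: Ishida1976, Ch. 7 eq. (7.7)] -/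
theorem stub_genus : ∀ (ℓ m : ℕ), ℓ.Prime → ℓ % 3 = 1 → padicValNat ℓ m = 1 →
    ∀ (K : Type) [Field K] [NumberField K], Module.finrank ℚ K = 3 →
      ∀ α : K, α ^ 3 = (m : K) → 3 ∣ NumberField.classNumber K :=
  fun _ _ hℓ hℓ1 hm K _ _ h3 α hα =>
    Literature.NumberTheory.NumberFields.Honda1971.three_dvd_classNumber_of_padicValNat_eq_one
      hℓ hℓ1 hm K h3 α hα

end Summit.QuantumAdvantage.QuantumAdvantage.Theorems.LinnikCubicClassGroups
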